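import Literature.MathematicalPhysics.QuantumFieldTheory.Balaban1983to89.B9SupplySockB9P3ZdDatum
import Literature.MathematicalPhysics.QuantumFieldTheory.Balaban1983to89.B9Thm311InvAtHIWitnessCubeZdFamily
import Literature.MathematicalPhysics.QuantumFieldTheory.Balaban1983to89.B9Thm33GreenL2BoundCubeZd
import Literature.MathematicalPhysics.QuantumFieldTheory.Balaban1983to89.B9Thm311CoerciveCompactZd

/-!
# `Balaban1983to89.B9Thm33GlobalBlockWitnessCubeZd` — [Balaban1985BackgroundPropagators] Thm 3.3 (3.47) p. 398 ∕ [Balaban1985RegularSpaces] (1.59) p. 86: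
# THE THREE GLOBAL (3.47) ENTRIES OF THE GENUINE `G_𝔤(U₀)` AT `γ = −3`, PER CUBE MEMBER, ON THE DATA OF THE JUNCTION — `GlobAtI` INHABITED — AND
# THE β COLLAR SOCKET OF [B8] (1.59) AT EVERY CUBE MEMBER FOR THE GENUINE RECORD, UNCONDITIONAL (member-dependent `B₀`, `aI`)

statement-level skeleton of published theorems with citation tags; proofs where landed; nothing here is a claim about the
Yang–Mills mass gap

`[Balaban1985BackgroundPropagators]` ("B9", CMP **99** (1985) 389–434; journal page = PDF page + 388): Thm 3.3 p. 399, (3.47) p. 398 (`|Gλ|_{(2+γ)},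
|∇_UGλ|_{(1+γ)}, |Δ_UGλ|_{(γ)} ≤ B₀|λ|_{(γ)}`), (3.42) p. 397, (3.27) p. 395, Thm 3.11 p. 416, (3.34)–(3.36) p. 396.  `[Balaban1984PropagatorsII]` ("[4]") p. 226,
(2.22) («Δ_a is bounded from below by a positive constant … hence»).  `[Balaban1985RegularSpaces]` ("B8") (1.58)–(1.59) p. 86, (1.7) p. 77, (1.131) p. 99.

CITATION HEADER ∕ WHY THIS FILE (cell `pub-ymgap`, HUMAN RULING D-0062; seat `pub-ymgap-dag-n06-b` (g20), binder∕letter owner of the junction J-N06→N05).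
The frame-free member supplier `B9SupplySockB9P3ZdDatum.sockB9P3D4βU_at` (g20, EDITION U) takes five binders on one operator record; at a cube member and
the genuine record `withGopZdH (opsAllZd τ L (cubeLamBP …) ops₀)` four of them are landed theorems (`InvAtHI` g20, `CurvAtInAk` dag-n06-w2∕w4, `AvgAtγ`
g19, and `LandauAtU` — §1 here, the Landau projection kills Landau fields at every unitary background).  THIS FILE inhabits the fifth, `GlobAtI` — the three
global (3.47) entries n = 0, 1, 3 at `γ = −3` that [B8] p. 86 reads for (1.59) — PER MEMBER, with a member-dependent constant `B₀`, by [4] (2.22)'s route in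
the datum's currency: §2 the coercivity constant `c` of dag-n06-w4 g4 (`B9Thm311CoerciveCompactZd.exists_coercive_closedBall_one_cube`, uniform ball) moved
to the local class «plaquettes touching `□₀` are `α`-close» by this seat's layer-gauge schema (`B9Thm311PerMemberCubeZdTouching.of_touching_plaquettes_unitary`,
(G) = w4's `coercive_opsAllZd_gaugeAct`, (L) = g20's sides locality); §3 `‖G_𝔤(U₀)J‖_τ ≤ c⁻¹‖herm 𝟙_{□₀}J‖_τ` (w4's `bondPair_gopZdH_self_le_of_coercive`);
§4 from `L²_τ` to the sup norms of (3.47) on the finite bond set of `□₀` (a fibre constant `κ_τ‖a‖² ≤ Re τ(a*a)` by compactness of the unit sphere, the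
`C_τ` of the hypothesis `|Re τ(x*y)| ≤ C_τ‖x‖‖y‖`, the level-`0` weight `η³` of `|J|₍₋₃₎`); §5 the three lines; §6 the socket.

WHAT IS PROVED (kernel, 0 sorry, 0 def; no `instance`, no `notation`).
* §0 `exists_norm_sq_le_re_trace` (f.d. fibre, faithful `τ`: `∃ κ > 0, κ‖a‖² ≤ Re τ(a*a)`), `norm_hermPart_le`, `norm_restrictLinH_apply_le`.
* §1 ★ `landauAtU_withGopZdH_opsAllZd` (finite `Ω₀`).
* §2 ★★ `exists_coercive_of_plaqTouches_cube`; §3 ★★ `exists_coercive_regularAtH_of_plaqTouches_cube`.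
* §4 ★★ `exists_apply_bound_gopZdH_of_plaqTouches_cube` (`∃ α > 0, ∃ N`, every unitary `U₀` with touching plaquettes `α`-close, every `J`, every bond:
  `‖(G_𝔤(U₀)J)(b)‖ ≤ N·|J|₍₋₃₎`).
* §5 ★★★ `globAtI_withGopZdH_opsAllZd_cube` (`∃ aT B₀ > 0, GlobAtI L (withGopZdH (opsAllZd τ L (cubeLamBP …) ops₀)) aT B₀ M i m`).
* §6 ★★★★ `sockB9P3D4β_genuine_cube` — AT EVERY CUBE MEMBER (`Ω = cubeFam false L a Mc ρ k`, `Λs = cubeLamS …`, `m ≤ k`, `2 ≤ d`, `2 ≤ L ≤ ρ`), faithful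
  Hermitian tracial `τ` with `C_τ`, `M ≥ 1`: `∃ aI B₀ > 0`, `SockB9P3D4β L B₀′ ((20d+2)B₀′) cP i.η m i.Ω i.Λs (cubeLamBP …)` for the GENUINE record, with
  `B₀′ = max{1, 2B₀max{1,q}}`, `q = qQ d L C_τ β_τ 1`, `cP = min{1∕16, aI, 1∕(2B₀·14(d−1)·M + 1)}` — NO displayed hypothesis of Bałaban's.

HONEST SCOPE ∕ A6.  Per member: `B₀`, `aI` are EXISTENTIAL and MEMBER-DEPENDENT (compactness∕continuity + finite-dimensional norm equivalence on `E(□₀)` —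
the crude route of [4] (2.22), NOT print's (3.42) decay with uniform `B₀, δ₀`, NOT Thm 3.3's uniformity in the member, which [B8]'s Theorem 4 driver needs
across the whole cube family); so this is the A6∕consistency certificate of the junction at each member, not a node discharge.  Count-neutral helper of K1⁸
(`--supports stmt-QuantumFields-26907`); N05∕N06 NOT discharged; one finite `𝕋⁴` programme at fixed `ε`, Bałaban as printed; R4 closes only the conditional
finite-`𝕋⁴` rung `BalabanLadder.UV` — nothing continuum ∕ `ℝ⁴` ∕ OS ∕ mass gap ∕ Clay.  Unit `pub-ymgap-dag-n06-b` (g20), 2026-08-28.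
-/

noncomputable section

open scoped BigOperators
open NormedSpace

namespace Literature.MathematicalPhysics.QuantumFieldTheory.Balaban1983to89.B9Thm33GlobalBlockWitnessCubeZd

open B7Prop1Explicit (e gaugeAct U1)
open B7Prop1Local (InBox)
open B7Prop2Explicit (unitaryUnits unitaryUnits_le_U1)
open B8Ineq132 (PlaqTouches BondTouches plaqF InAk covDerivFwd)
open B8Eq140Level (SideTouches)
open B8ScaledSupNorm (bondNorm msup weight Bdd)
open B8Eq138LandauZd (IsLandau138 covLap covDivB)
open B8Eq131Cubes (cube sqLo sqHi)
open B8Eq131CubesAdmissible (cubeFam cubeFam_false_zero)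
open B8CubeMemberZd (cubeLamS)
open B8Ineq159FlatCubeMemberPrinted (cubeLamBP)
open B8Ineq159FlatCubeMemberKernel (mem_cube_zero_iff)
open B8LeafModelZd (ZdIdx)
open B9SupplySockB9P3ZdLetters (OpsZd deltaAOf)
open B9SupplySockB9P3ZdLettersOmega (OnDom Margin2 margin2_cubeFam norm_covDerivFwd_le norm_covLap_le)
open B9SupplySockB9P3ZdBeta (SockB9P3D4β)
open B9SupplySockB9P3ZdGamma (SeesDom AvgAtγ seesDom_cubeLamBP)
open B9SupplySockB9P3ZdGammaInAk (CurvAtInAk)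
open B9Eq321LandauProjectionZd (opsLandau projR opsLandau_DRDs_of_finite projR_covDivB_eq_zero_of_isLandau138)
open B9Eq327GreenZd (domSub bondPair setOf_bondTouches_finite)
open B9Eq327GreenZdHerm (hermPart domSubH domSubH_le RegularAtH gopZdH withGopZdH withGopZdH_Gop restrictLinH gopZdH_mem_domSubH)
open B9Eq316AveragingTransposeZd (tauForm tauForm_apply qQ betaTau)
open B9Eq316AveragingTransposeZdLevelZero (avgAtγ_opsAllZd_cubeLamBP)
open B9SupplySockB9P3ZdAllLettersZd (opsAllZd curvAtInAk_opsAllZd)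
open B9SupplySockB9P3ZdAtHermInAk (InvAtHI invAtHI_anti)
open B9SupplySockB9P3ZdDatum (LandauAtU GlobAtI globAtI_anti sockB9P3D4βU_at)
open B9Thm311PerMemberCubeZdTouching (of_touching_plaquettes_unitary sqLo_le_sqHi_zero regularAtH_of_plaqTouches_cube)
open B9Thm311InvAtHIWitnessCubeZd (invAtHI_withGopZdH_opsAllZd_cube curvAtInAk_withGopZdH_iff avgAtγ_withGopZdH_iff)
open B9Eq326DeltaALocalityZdSides (regular_opsAllZd_congr_cube_sides)
open B9Thm311CoerciveCompactZd (exists_coercive_closedBall_one_cube coercive_opsAllZd_gaugeAct)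
open B9Thm33GreenL2BoundCubeZd (bondPair_gopZdH_self_le_of_coercive)
open B9Thm311FlatHermKernelZd (bondPair_eq_sum_of_vanish_off)
open B9Thm311PosDefOpenZd (cubeMember_Ω0_finite)
open B9Eq333ProjectionCovarianceZd (gaugeAct_inv_gaugeAct inv_mem_unitaryUnits)
open B9Eq334GaugeCovarianceZd (gaugeAct_mem_unitaryUnits')

export B7Prop1Explicit (Site)

variable {d : ℕ} {𝔸 : Type*} [CStarAlgebra 𝔸]

/-! ## §0 Fibre constants -/

section Fibre

/-- **THE FIBRE NORM IS DOMINATED BY THE τ-NORM** (finite-dimensional fibre, faithful `τ`): `∃ κ > 0` with `κ‖a‖² ≤ Re τ(a*a)` for all `a` — the unit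
sphere is compact and `a ↦ Re τ(a*a)` is continuous and positive on it. [cite: Balaban1985BackgroundPropagators, p.390 («|X|² = tr X*X», finite-dimensional fibre)] -/
theorem exists_norm_sq_le_re_trace [FiniteDimensional ℝ 𝔸] [Nontrivial 𝔸] (τ : 𝔸 →ₗ[ℂ] ℂ)
    (hτp : ∀ a : 𝔸, a ≠ 0 → 0 < (τ (star a * a)).re) :
    ∃ κ : ℝ, 0 < κ ∧ ∀ a : 𝔸, κ * ‖a‖ ^ 2 ≤ (τ (star a * a)).re := by
  have hcont : Continuous fun a : 𝔸 => (τ (star a * a)).re := by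
    have hτc : Continuous fun a : 𝔸 => τ a := (τ.restrictScalars ℝ).continuous_of_finiteDimensional
    exact Complex.continuous_re.comp (hτc.comp (continuous_star.mul continuous_id))
  have hK : IsCompact (Metric.sphere (0 : 𝔸) 1) := isCompact_sphere 0 1
  obtain ⟨x₀, hx₀⟩ : ∃ x : 𝔸, x ≠ 0 := exists_ne 0
  have hne : (Metric.sphere (0 : 𝔸) 1).Nonempty := by
    refine ⟨‖x₀‖⁻¹ • x₀, ?_⟩
    rw [mem_sphere_zero_iff_norm, norm_smul, norm_inv, norm_norm, inv_mul_cancel₀ (norm_ne_zero_iff.mpr hx₀)]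
  obtain ⟨u, hu, hmin⟩ := hK.exists_isMinOn hne hcont.continuousOn
  have hu0 : u ≠ 0 := by
    intro h
    rw [h, mem_sphere_zero_iff_norm, norm_zero] at hu
    exact zero_ne_one hu
  refine ⟨(τ (star u * u)).re, hτp u hu0, fun a => ?_⟩
  by_cases ha : a = 0
  · subst ha
    simp
  · have hna : 0 < ‖a‖ := norm_pos_iff.mpr ha
    have hv : ‖a‖⁻¹ • a ∈ Metric.sphere (0 : 𝔸) 1 := by
      rw [mem_sphere_zero_iff_norm, norm_smul, norm_inv, norm_norm, inv_mul_cancel₀ hna.ne']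
    have hmv : (τ (star u * u)).re ≤ (τ (star (‖a‖⁻¹ • a) * (‖a‖⁻¹ • a))).re := hmin hv
    have hscale : (τ (star (‖a‖⁻¹ • a) * (‖a‖⁻¹ • a))).re = ‖a‖⁻¹ * (‖a‖⁻¹ * (τ (star a * a)).re) := by
      have h := tauForm_apply τ (‖a‖⁻¹ • a) (‖a‖⁻¹ • a)
      rw [← h, map_smul, map_smul, LinearMap.smul_apply, smul_eq_mul, smul_eq_mul, tauForm_apply]
    rw [hscale] at hmv
    have h2 : ‖a‖ ^ 2 * (‖a‖⁻¹ * (‖a‖⁻¹ * (τ (star a * a)).re)) = (τ (star a * a)).re := by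
      field_simp
    calc (τ (star u * u)).re * ‖a‖ ^ 2 = ‖a‖ ^ 2 * (τ (star u * u)).re := by ring
      _ ≤ ‖a‖ ^ 2 * (‖a‖⁻¹ * (‖a‖⁻¹ * (τ (star a * a)).re)) := mul_le_mul_of_nonneg_left hmv (by positivity)
      _ = (τ (star a * a)).re := h2

/-- `‖herm a‖ ≤ ‖a‖` (`‖a*‖ = ‖a‖`). [cite: Balaban1985BackgroundPropagators, p.391 (bookkeeping)] -/
theorem norm_hermPart_le (a : 𝔸) : ‖hermPart a‖ ≤ ‖a‖ := by
  unfold hermPart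
  calc ‖(2 : ℝ)⁻¹ • (a + star a)‖ ≤ ‖(2 : ℝ)⁻¹‖ * (‖a‖ + ‖star a‖) := by
        rw [norm_smul]; exact mul_le_mul_of_nonneg_left (norm_add_le _ _) (norm_nonneg _)
    _ = ‖a‖ := by rw [norm_star, Real.norm_eq_abs, abs_of_pos (by norm_num)]; ring

/-- `‖(herm 𝟙_{Ω₀}J)(b)‖ ≤ ‖J(b)‖` at every bond. [cite: Balaban1985BackgroundPropagators, (3.27) p.395 (bookkeeping)] -/
theorem norm_restrictLinH_apply_le (Ω₀ : Set (Site d)) (J : Site d → Fin d → 𝔸) (y : Site d) (μ : Fin d) :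
    ‖(restrictLinH (𝔸 := 𝔸) Ω₀ J : Site d → Fin d → 𝔸) y μ‖ ≤ ‖J y μ‖ := by
  classical
  show ‖(if BondTouches Ω₀ y μ then hermPart (J y μ) else 0)‖ ≤ ‖J y μ‖
  split_ifs
  · exact norm_hermPart_le _
  · rw [norm_zero]; exact norm_nonneg _

end Fibre

/-! ## §1 `LandauAtU` for the genuine record -/

section Landau

variable [FiniteDimensional ℝ 𝔸] [Nontrivial 𝔸] (τ : 𝔸 →ₗ[ℂ] ℂ) {L : ℕ}
  (hτp : ∀ a : 𝔸, a ≠ 0 → 0 < (τ (star a * a)).re) (hτt : ∀ a b : 𝔸, τ (a * b) = τ (b * a))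
  (hτs : ∀ a : 𝔸, τ (star a) = starRingEnd ℂ (τ a))

omit [Nontrivial 𝔸] in
include hτp hτt hτs in
/-- ★ **THE GENUINE `D R(U₀) 𝟙 D*` KILLS LANDAU FIELDS AT EVERY UNITARY BACKGROUND** (finite `Ω₀`): `LandauAtU L (withGopZdH (opsAllZd τ L ΛbP ops₀)) M i m`.
[cite: Balaban1985BackgroundPropagators, (3.20)–(3.21) p.394, (3.26) p.395; Balaban1985RegularSpaces, (1.38) p.82] -/
theorem landauAtU_withGopZdH_opsAllZd [NeZero L] (ΛbP : ℕ → ℕ → Set (Site d × Fin d)) (ops₀ : ℝ → ZdIdx d L → ℕ → OpsZd d 𝔸) (M : ℝ)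
    (i : ZdIdx d L) (m : ℕ) (hΩ : (i.Ω 0).Finite) : LandauAtU L (withGopZdH (opsAllZd τ L ΛbP ops₀)) M i m := by
  intro U₀ hU₀ A _ hL x μ
  show (opsLandau τ (B9SupplySockB9P3ZdGammaInAkDpZd.withDpZd (B9Eq316AveragingTransposeZdPrinted.withQQP τ L ΛbP ops₀)) M i m).DRDs U₀ A x μ = 0
  rw [opsLandau_DRDs_of_finite τ _ M i m hΩ]
  have hs : (↑hΩ.toFinset : Set (Site d)) = i.Ω 0 := hΩ.coe_toFinset
  have h' : IsLandau138 L m i.η (↑hΩ.toFinset : Set (Site d)) (i.Λs m) U₀ A := by rw [hs]; exact hL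
  rw [projR_covDivB_eq_zero_of_isLandau138 hτt hτs hτp hU₀ h']
  exact B8Eq138LandauZd.covDerivFwd_zero_fun i.η U₀ μ x

end Landau

/-! ## §2–§3 Coercivity (and regularity) on the touching class -/

section Coercive

variable [FiniteDimensional ℝ 𝔸] [Nontrivial 𝔸] (τ : 𝔸 →ₗ[ℂ] ℂ) {L : ℕ}
  (hτp : ∀ a : 𝔸, a ≠ 0 → 0 < (τ (star a * a)).re) (hτt : ∀ a b : 𝔸, τ (a * b) = τ (b * a))
  (hτs : ∀ a : 𝔸, τ (star a) = starRingEnd ℂ (τ a))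

include hτp hτt hτs in
/-- ★★ **ONE COERCIVITY CONSTANT FOR THE GENUINE `Δ_a(U₀)` ON `E_𝔤(□₀)` OVER THE LOCAL CLASS «PLAQUETTES TOUCHING `□₀` ARE `α`-CLOSE»** (cube member, class
`cubeLamBP`, `m ≤ k`, `2 ≤ d`, `2 ≤ L ≤ ρ`): `∃ α c > 0`, every unitary `U₀` with `‖U₀(∂p) − 1‖ ≤ α` on the plaquettes touching `□₀` has
`c·⟨A, A⟩_τ ≤ ⟨A, Δ_a(U₀)A⟩_τ` for every Hermitian `A ∈ E(□₀)` — dag-n06-w4 g4's uniform-ball constant (`exists_coercive_closedBall_one_cube`) moved to the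
datum's class by the layer-gauge schema ((G) `coercive_opsAllZd_gaugeAct`, (L) `regular_opsAllZd_congr_cube_sides`).
[cite: Balaban1984PropagatorsII, (2.22) p.226; Balaban1985BackgroundPropagators, Thm 3.11 p.416, (3.34)–(3.36) p.396; Balaban1985RegularSpaces, (1.7) p.77, Lemma 1 p.79] -/
theorem exists_coercive_of_plaqTouches_cube (hd2 : 2 ≤ d) (hL : 2 ≤ L) (ops₀ : ℝ → ZdIdx d L → ℕ → OpsZd d 𝔸) (M : ℝ) (i : ZdIdx d L)
    {a : Site d} {Mc ρ : ℕ} (hρ : L ≤ ρ) (hΩ : i.Ω = cubeFam false L a Mc ρ i.k) (hΛs : i.Λs = cubeLamS L a Mc ρ i.k) {m : ℕ} (hm : m ≤ i.k) :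
    ∃ α : ℝ, 0 < α ∧ ∃ c : ℝ, 0 < c ∧ ∀ U₀ : Site d → Fin d → 𝔸ˣ, (∀ x κ, U₀ x κ ∈ unitaryUnits 𝔸) →
      (∀ (z : Site d) (κ μ : Fin d), κ ≠ μ → PlaqTouches (i.Ω 0) z κ μ → ‖plaqF U₀ κ μ z - 1‖ ≤ α) →
        ∀ A ∈ domSubH (𝔸 := 𝔸) (i.Ω 0),
          c * bondPair τ A A ≤ bondPair τ A (deltaAOf i.η (opsAllZd τ L (cubeLamBP L a Mc ρ i.k) ops₀ M i m) U₀ A) := by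
  have hL1 : 1 ≤ L := le_trans (by norm_num) hL
  have hfin : (i.Ω 0).Finite := cubeMember_Ω0_finite i hΩ
  have hset : {y : Site d | InBox (sqLo L a ρ i.k 0) (sqHi L a Mc ρ i.k 0) y} = i.Ω 0 := by
    rw [hΩ, cubeFam_false_zero]; ext y; exact (mem_cube_zero_iff L a Mc ρ i.k y).symm
  obtain ⟨δ, hδ, c, hc, hball⟩ := exists_coercive_closedBall_one_cube τ hτp hτt hτs hd2 hL ops₀ M i hρ hΩ hΛs hm
  -- the property `P U := c·⟨A,A⟩ ≤ ⟨A, Δ_a(U)A⟩ on E_𝔤(□₀)` with the FIXED `c`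
  have hB : ∃ δ' : ℝ, 0 < δ' ∧ ∀ V : Site d → Fin d → 𝔸ˣ, (∀ x κ, V x κ ∈ unitaryUnits 𝔸) →
      (∀ x κ, ‖((V x κ : 𝔸ˣ) : 𝔸) - 1‖ < δ') →
        ∀ A ∈ domSubH (𝔸 := 𝔸) (i.Ω 0),
          c * bondPair τ A A ≤ bondPair τ A (deltaAOf i.η (opsAllZd τ L (cubeLamBP L a Mc ρ i.k) ops₀ M i m) V A) :=
    ⟨δ, hδ, fun V hV hVδ => hball V hV fun x κ => (hVδ x κ).le⟩
  have hG : ∀ (u : Site d → 𝔸ˣ) (V : Site d → Fin d → 𝔸ˣ), (∀ x, u x ∈ unitaryUnits 𝔸) → (∀ x κ, V x κ ∈ unitaryUnits 𝔸) →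
      (∀ A ∈ domSubH (𝔸 := 𝔸) (i.Ω 0),
          c * bondPair τ A A ≤ bondPair τ A (deltaAOf i.η (opsAllZd τ L (cubeLamBP L a Mc ρ i.k) ops₀ M i m) V A)) →
        ∀ A ∈ domSubH (𝔸 := 𝔸) (i.Ω 0),
          c * bondPair τ A A ≤ bondPair τ A (deltaAOf i.η (opsAllZd τ L (cubeLamBP L a Mc ρ i.k) ops₀ M i m) (gaugeAct u V) A) := by
    intro u V hu hV hP
    have hP' : ∀ A ∈ domSubH (𝔸 := 𝔸) (i.Ω 0), c * bondPair τ A A ≤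
        bondPair τ A (deltaAOf i.η (opsAllZd τ L (cubeLamBP L a Mc ρ i.k) ops₀ M i m) (gaugeAct u⁻¹ (gaugeAct u V)) A) := by
      rw [gaugeAct_inv_gaugeAct]; exact hP
    exact coercive_opsAllZd_gaugeAct τ hτp hτt hτs hL ops₀ M i hρ hΩ hm (inv_mem_unitaryUnits hu) (gaugeAct_mem_unitaryUnits' hV hu) hP'
  have hLoc : ∀ (U U' : Site d → Fin d → 𝔸ˣ), (∀ x κ, U x κ ∈ unitaryUnits 𝔸) → (∀ x κ, U' x κ ∈ unitaryUnits 𝔸) →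
      (∀ (y : Site d) (τ' : Fin d), SideTouches {z | InBox (sqLo L a ρ i.k 0) (sqHi L a Mc ρ i.k 0) z} y τ' → U y τ' = U' y τ') →
      (∀ A ∈ domSubH (𝔸 := 𝔸) (i.Ω 0),
          c * bondPair τ A A ≤ bondPair τ A (deltaAOf i.η (opsAllZd τ L (cubeLamBP L a Mc ρ i.k) ops₀ M i m) U A)) →
        ∀ A ∈ domSubH (𝔸 := 𝔸) (i.Ω 0),
          c * bondPair τ A A ≤ bondPair τ A (deltaAOf i.η (opsAllZd τ L (cubeLamBP L a Mc ρ i.k) ops₀ M i m) U' A) := by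
    intro U U' _ _ hag hP A hA
    rw [hset] at hag
    rw [← (regular_opsAllZd_congr_cube_sides τ hd2 hL ops₀ M i hρ hΩ hΛs hfin hm hag).2.2.2 A (domSubH_le _ hA)]
    exact hP A hA
  obtain ⟨α, hα, hmain⟩ := of_touching_plaquettes_unitary (sqLo_le_sqHi_zero L a Mc (le_trans hL1 hρ) i.k) hB hG hLoc
  exact ⟨α, hα, c, hc, fun U₀ hU₀ hsmall => hmain U₀ hU₀ fun z κ μ hκμ hpt => hsmall z κ μ hκμ (by rw [hset] at hpt; exact hpt)⟩

include hτp hτt hτs in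
/-- ★★ **COERCIVITY AND REGULARITY TOGETHER ON THE TOUCHING CLASS** — the pair a step of [4] (2.22) starts from. [cite: Balaban1984PropagatorsII, (2.22) p.226; Balaban1985BackgroundPropagators, Thm 3.11 p.416, (3.27) p.395] -/
theorem exists_coercive_regularAtH_of_plaqTouches_cube (hd2 : 2 ≤ d) (hL : 2 ≤ L) (ops₀ : ℝ → ZdIdx d L → ℕ → OpsZd d 𝔸) (M : ℝ) (i : ZdIdx d L)
    {a : Site d} {Mc ρ : ℕ} (hρ : L ≤ ρ) (hΩ : i.Ω = cubeFam false L a Mc ρ i.k) (hΛs : i.Λs = cubeLamS L a Mc ρ i.k) {m : ℕ} (hm : m ≤ i.k) :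
    ∃ α : ℝ, 0 < α ∧ ∃ c : ℝ, 0 < c ∧ ∀ U₀ : Site d → Fin d → 𝔸ˣ, (∀ x κ, U₀ x κ ∈ unitaryUnits 𝔸) →
      (∀ (z : Site d) (κ μ : Fin d), κ ≠ μ → PlaqTouches (i.Ω 0) z κ μ → ‖plaqF U₀ κ μ z - 1‖ ≤ α) →
        (∀ A ∈ domSubH (𝔸 := 𝔸) (i.Ω 0),
            c * bondPair τ A A ≤ bondPair τ A (deltaAOf i.η (opsAllZd τ L (cubeLamBP L a Mc ρ i.k) ops₀ M i m) U₀ A)) ∧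
          RegularAtH i.η (opsAllZd τ L (cubeLamBP L a Mc ρ i.k) ops₀ M i m) (i.Ω 0) U₀ := by
  obtain ⟨α₁, hα₁, c, hc, h₁⟩ := exists_coercive_of_plaqTouches_cube τ hτp hτt hτs hd2 hL ops₀ M i hρ hΩ hΛs hm
  obtain ⟨α₂, hα₂, h₂⟩ := regularAtH_of_plaqTouches_cube τ hτp hτt hτs hd2 hL ops₀ M i hρ hΩ hΛs hm
  refine ⟨min α₁ α₂, lt_min hα₁ hα₂, c, hc, fun U₀ hU₀ hsmall => ⟨?_, ?_⟩⟩
  · exact h₁ U₀ hU₀ fun z κ μ hκμ hpt => (hsmall z κ μ hκμ hpt).trans (min_le_left _ _)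
  · exact (h₂ U₀ hU₀ fun z κ μ hκμ hpt => (hsmall z κ μ hκμ hpt).trans (min_le_right _ _)).1

end Coercive

/-! ## §4 From `L²_τ` to the sup norms: the pointwise bound on `(G_𝔤(U₀)J)(b)` -/

section Pointwise

variable [FiniteDimensional ℝ 𝔸] [Nontrivial 𝔸] (τ : 𝔸 →ₗ[ℂ] ℂ) {L : ℕ}
  (hτp : ∀ a : 𝔸, a ≠ 0 → 0 < (τ (star a * a)).re) (hτt : ∀ a b : 𝔸, τ (a * b) = τ (b * a))
  (hτs : ∀ a : 𝔸, τ (star a) = starRingEnd ℂ (τ a))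

omit [FiniteDimensional ℝ 𝔸] [Nontrivial 𝔸] in
/-- at a member with finite `Ω₀`, every bond field's `|J|₍₋₃₎`-family is bounded (finite index set), and `η³‖J(b)‖ ≤ |J|₍₋₃₎` on the bonds of `Ω₀`.
[cite: Balaban1985RegularSpaces, p.86 (definition of `|·|_{(γ)}`); Balaban1985BackgroundPropagators, (3.41) p.397] -/
theorem eta_cube_mul_norm_le_bondNorm (hL : 1 ≤ L) (i : ZdIdx d L) (m : ℕ) (hΩ : (i.Ω 0).Finite) (J : Site d → Fin d → 𝔸)
    {y : Site d} {μ : Fin d} (hb : BondTouches (i.Ω 0) y μ) :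
    i.η ^ 3 * ‖J y μ‖ ≤ bondNorm L m i.η (-(3 : ℝ)) i.Ω J := by
  classical
  have hη : 0 < i.η := i.hη
  have e3 : (-(3 : ℝ)) = -((3 : ℕ) : ℝ) := by norm_num
  -- boundedness: every index bond touches `Ω₀` (finite)
  obtain ⟨T, hT_def⟩ : ∃ T : Finset (Site d × Fin d), T = (setOf_bondTouches_finite (d := d) hΩ).toFinset := ⟨_, rfl⟩
  have hmemT : ∀ b : Site d × Fin d, b ∈ T ↔ BondTouches (i.Ω 0) b.1 b.2 := fun b => by
    rw [hT_def, Set.Finite.mem_toFinset]; rfl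
  have hBdd : Bdd L m i.η (-(3 : ℝ)) (fun j (b : Site d × Fin d) => BondTouches (i.Ω j) b.1 b.2) (fun b => J b.1 b.2) := by
    refine B8ScaledSupNorm.bdd_of_forall (c := ((L : ℝ) ^ m * i.η) ^ 3 * ∑ b ∈ T, ‖J b.1 b.2‖) fun j hj b hbj => ?_
    rw [e3, B8ScaledSupNorm.weight_neg_natCast]
    have hb0 : BondTouches (i.Ω 0) b.1 b.2 := by
      rcases hbj with h | h
      · exact Or.inl (B9SupplySockB9P3ZdLettersOmega.omega_subset_of_le i (Nat.zero_le j) h)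
      · exact Or.inr (B9SupplySockB9P3ZdLettersOmega.omega_subset_of_le i (Nat.zero_le j) h)
    have hmem : b ∈ T := (hmemT b).2 hb0
    have hle : ‖J b.1 b.2‖ ≤ ∑ b' ∈ T, ‖J b'.1 b'.2‖ := Finset.single_le_sum (fun b' _ => norm_nonneg (J b'.1 b'.2)) hmem
    have hLr : (1 : ℝ) ≤ L := by exact_mod_cast hL
    have hw : ((L : ℝ) ^ j * i.η) ^ 3 ≤ ((L : ℝ) ^ m * i.η) ^ 3 := by
      apply pow_le_pow_left₀ (by positivity)
      exact mul_le_mul_of_nonneg_right (pow_le_pow_right₀ hLr hj) hη.le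
    exact mul_le_mul hw hle (norm_nonneg _) (by positivity)
  have h := B8ScaledSupNorm.weight_mul_norm_le_msup hBdd (Nat.zero_le m) (i := (y, μ)) hb
  rw [e3, B8ScaledSupNorm.weight_neg_natCast, pow_zero, one_mul] at h
  exact h

include hτp hτt hτs in
/-- ★★ **A SUP-NORM BOUND FOR THE GENUINE PROPAGATOR ON THE TOUCHING CLASS, PER MEMBER**: `∃ α > 0, ∃ N ≥ 0`, every unitary `U₀` whose plaquettes touching
`□₀` are `α`-close to `1`, every bond field `J`, every bond `b`: `‖(G_𝔤(U₀)J)(b)‖ ≤ N·|J|₍₋₃₎` — [4] (2.22) (`‖G_𝔤‖_{L²_τ} ≤ c⁻¹`, dag-n06-w4 g4) plus the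
finite-dimensional comparison of the `τ`-norms with the fibre norm on the `|∂□₀|`-many bonds.
[cite: Balaban1984PropagatorsII, (2.22) p.226; Balaban1985BackgroundPropagators, Thm 3.3 p.399, (3.47) p.398, (3.27) p.395] -/
theorem exists_apply_bound_gopZdH_of_plaqTouches_cube (hd2 : 2 ≤ d) (hL : 2 ≤ L)
    {Cτ : ℝ} (hCτ : ∀ x y : 𝔸, |(τ (star x * y)).re| ≤ Cτ * ‖x‖ * ‖y‖)
    (ops₀ : ℝ → ZdIdx d L → ℕ → OpsZd d 𝔸) (M : ℝ) (i : ZdIdx d L)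
    {a : Site d} {Mc ρ : ℕ} (hρ : L ≤ ρ) (hΩ : i.Ω = cubeFam false L a Mc ρ i.k) (hΛs : i.Λs = cubeLamS L a Mc ρ i.k) {m : ℕ} (hm : m ≤ i.k) :
    ∃ α : ℝ, 0 < α ∧ ∃ N : ℝ, 0 ≤ N ∧ ∀ U₀ : Site d → Fin d → 𝔸ˣ, (∀ x κ, U₀ x κ ∈ unitaryUnits 𝔸) →
      (∀ (z : Site d) (κ μ : Fin d), κ ≠ μ → PlaqTouches (i.Ω 0) z κ μ → ‖plaqF U₀ κ μ z - 1‖ ≤ α) →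
        RegularAtH i.η (opsAllZd τ L (cubeLamBP L a Mc ρ i.k) ops₀ M i m) (i.Ω 0) U₀ ∧
        ∀ (J : Site d → Fin d → 𝔸) (y : Site d) (μ : Fin d),
          ‖gopZdH i.η (opsAllZd τ L (cubeLamBP L a Mc ρ i.k) ops₀ M i m) (i.Ω 0) U₀ J y μ‖ ≤ N * bondNorm L m i.η (-(3 : ℝ)) i.Ω J := by
  classical
  have hL1 : 1 ≤ L := le_trans (by norm_num) hL
  have hη : 0 < i.η := i.hη
  have hfin : (i.Ω 0).Finite := cubeMember_Ω0_finite i hΩ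
  obtain ⟨α, hα, c, hc, h⟩ := exists_coercive_regularAtH_of_plaqTouches_cube τ hτp hτt hτs hd2 hL ops₀ M i hρ hΩ hΛs hm
  obtain ⟨κ, hκ, hκle⟩ := exists_norm_sq_le_re_trace τ hτp
  have hCτ0 : 0 ≤ Cτ := by
    have h1 := hCτ 1 1
    rw [star_one, one_mul, norm_one, mul_one, mul_one] at h1
    exact le_trans (abs_nonneg _) h1
  obtain ⟨T, hT_def⟩ : ∃ T : Finset (Site d × Fin d), T = (setOf_bondTouches_finite (d := d) hfin).toFinset := ⟨_, rfl⟩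
  have hmemT : ∀ b : Site d × Fin d, b ∈ T ↔ BondTouches (i.Ω 0) b.1 b.2 := fun b => by
    rw [hT_def, Set.Finite.mem_toFinset]; rfl
  -- the constant: `‖A(b)‖² ≤ K·(η⁻³|J|)²` with `K = #T·C_τ∕(κc²)`, and `K ≤ max 1 K ≤ (max 1 K)²`
  obtain ⟨K, hK_def⟩ : ∃ K : ℝ, K = (T.card : ℝ) * Cτ / (κ * c ^ 2) := ⟨_, rfl⟩
  have hK0 : 0 ≤ K := by rw [hK_def]; positivity
  refine ⟨α, hα, max 1 K * i.η⁻¹ ^ 3, by positivity, fun U₀ hU₀ hsmall => ?_⟩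
  obtain ⟨hcoer, hreg⟩ := h U₀ hU₀ hsmall
  refine ⟨hreg, fun J y μ => ?_⟩
  obtain ⟨A, hA_def⟩ : ∃ A : Site d → Fin d → 𝔸, A = gopZdH i.η (opsAllZd τ L (cubeLamBP L a Mc ρ i.k) ops₀ M i m) (i.Ω 0) U₀ J := ⟨_, rfl⟩
  obtain ⟨Jt, hJt_def⟩ : ∃ Jt : Site d → Fin d → 𝔸, Jt = (restrictLinH (𝔸 := 𝔸) (i.Ω 0) J : Site d → Fin d → 𝔸) := ⟨_, rfl⟩
  obtain ⟨nJ, hnJ_def⟩ : ∃ nJ : ℝ, nJ = bondNorm L m i.η (-(3 : ℝ)) i.Ω J := ⟨_, rfl⟩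
  rw [← hA_def, ← hnJ_def]
  have hnJ0 : 0 ≤ nJ := by rw [hnJ_def]; exact B8ScaledSupNorm.msup_nonneg L m hη.le _ _ _
  have hA : A ∈ domSubH (𝔸 := 𝔸) (i.Ω 0) := by rw [hA_def]; exact gopZdH_mem_domSubH i.η _ (i.Ω 0) U₀ J
  have hJt : Jt ∈ domSubH (𝔸 := 𝔸) (i.Ω 0) := by rw [hJt_def]; exact (restrictLinH (𝔸 := 𝔸) (i.Ω 0) J).2
  have hvanA : ∀ b : Site d × Fin d, b ∉ T → A b.1 b.2 = 0 := fun b hb => (domSubH_le _ hA) b.1 b.2 fun h => hb ((hmemT b).2 h)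
  have hvanJ : ∀ b : Site d × Fin d, b ∉ T → Jt b.1 b.2 = 0 := fun b hb => (domSubH_le _ hJt) b.1 b.2 fun h => hb ((hmemT b).2 h)
  -- (2.22): ⟨A, A⟩ ≤ c⁻² ⟨J̃, J̃⟩
  have hAA : bondPair τ A A ≤ c⁻¹ ^ 2 * bondPair τ Jt Jt := by
    rw [hA_def, hJt_def]
    exact bondPair_gopZdH_self_le_of_coercive τ hτp hτs i.η _ (i.Ω 0) U₀ hfin hreg hc hcoer J
  -- ‖J(b)‖ ≤ η⁻³|J| on the bonds of `□₀`
  have hJb : ∀ b ∈ T, ‖J b.1 b.2‖ ≤ i.η⁻¹ ^ 3 * nJ := by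
    intro b hb
    have hbt : BondTouches (i.Ω 0) b.1 b.2 := (hmemT b).1 hb
    have h1 := eta_cube_mul_norm_le_bondNorm (𝔸 := 𝔸) hL1 i m hfin J hbt
    rw [← hnJ_def] at h1
    have hη3 : 0 < i.η ^ 3 := by positivity
    rw [inv_pow, ← div_eq_inv_mul, le_div_iff₀ hη3]
    linarith [h1]
  -- ⟨J̃, J̃⟩ ≤ #T·C_τ·(η⁻³|J|)²
  have hJJ : bondPair τ Jt Jt ≤ (T.card : ℝ) * (Cτ * (i.η⁻¹ ^ 3 * nJ) ^ 2) := by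
    rw [bondPair_eq_sum_of_vanish_off τ T hvanJ Jt]
    have hterm : ∀ b ∈ T, tauForm τ (Jt b.1 b.2) (Jt b.1 b.2) ≤ Cτ * (i.η⁻¹ ^ 3 * nJ) ^ 2 := by
      intro b hb
      have hn : ‖Jt b.1 b.2‖ ≤ i.η⁻¹ ^ 3 * nJ := by
        rw [hJt_def]; exact (norm_restrictLinH_apply_le (i.Ω 0) J b.1 b.2).trans (hJb b hb)
      calc tauForm τ (Jt b.1 b.2) (Jt b.1 b.2) = (τ (star (Jt b.1 b.2) * Jt b.1 b.2)).re := tauForm_apply τ _ _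
        _ ≤ Cτ * ‖Jt b.1 b.2‖ * ‖Jt b.1 b.2‖ := (le_abs_self _).trans (hCτ _ _)
        _ ≤ Cτ * (i.η⁻¹ ^ 3 * nJ) * (i.η⁻¹ ^ 3 * nJ) := by
            apply mul_le_mul (mul_le_mul_of_nonneg_left hn hCτ0) hn (norm_nonneg _) (by positivity)
        _ = Cτ * (i.η⁻¹ ^ 3 * nJ) ^ 2 := by ring
    calc ∑ b ∈ T, tauForm τ (Jt b.1 b.2) (Jt b.1 b.2) ≤ ∑ b ∈ T, Cτ * (i.η⁻¹ ^ 3 * nJ) ^ 2 := Finset.sum_le_sum hterm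
      _ = (T.card : ℝ) * (Cτ * (i.η⁻¹ ^ 3 * nJ) ^ 2) := by rw [Finset.sum_const, nsmul_eq_mul]
  -- κ‖A(b)‖² ≤ ⟨A, A⟩
  by_cases hbt : BondTouches (i.Ω 0) y μ
  · have hmem : (y, μ) ∈ T := (hmemT (y, μ)).2 hbt
    have h1 : κ * ‖A y μ‖ ^ 2 ≤ bondPair τ A A := by
      rw [bondPair_eq_sum_of_vanish_off τ T hvanA A]
      refine (hκle (A y μ)).trans ?_
      rw [← tauForm_apply τ]
      exact Finset.single_le_sum (f := fun b : Site d × Fin d => tauForm τ (A b.1 b.2) (A b.1 b.2))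
        (fun b _ => by rw [tauForm_apply]; exact B9Thm311FlatHermKernelZd.re_trace_star_mul_self_nonneg' hτp _) hmem
    -- combine
    have hc2 : 0 < κ * c ^ 2 := by positivity
    have h2 : ‖A y μ‖ ^ 2 ≤ K * (i.η⁻¹ ^ 3 * nJ) ^ 2 := by
      rw [hK_def, div_mul_eq_mul_div, le_div_iff₀ hc2]
      have h3 : κ * c ^ 2 * ‖A y μ‖ ^ 2 ≤ c ^ 2 * bondPair τ A A := by nlinarith [h1, sq_nonneg c]
      have h4 : c ^ 2 * bondPair τ A A ≤ bondPair τ Jt Jt := by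
        have hc2' : c ^ 2 * (c⁻¹ ^ 2 * bondPair τ Jt Jt) = bondPair τ Jt Jt := by
          rw [← mul_assoc, ← mul_pow, mul_inv_cancel₀ hc.ne', one_pow, one_mul]
        calc c ^ 2 * bondPair τ A A ≤ c ^ 2 * (c⁻¹ ^ 2 * bondPair τ Jt Jt) := mul_le_mul_of_nonneg_left hAA (by positivity)
          _ = bondPair τ Jt Jt := hc2'
      calc ‖A y μ‖ ^ 2 * (κ * c ^ 2) = κ * c ^ 2 * ‖A y μ‖ ^ 2 := by ring
        _ ≤ bondPair τ Jt Jt := h3.trans h4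
        _ ≤ (T.card : ℝ) * (Cτ * (i.η⁻¹ ^ 3 * nJ) ^ 2) := hJJ
        _ = (T.card : ℝ) * Cτ * (i.η⁻¹ ^ 3 * nJ) ^ 2 := by ring
    have hmax : K ≤ (max 1 K) ^ 2 := by
      have h1' : (1 : ℝ) ≤ max 1 K := le_max_left _ _
      calc K ≤ max 1 K := le_max_right _ _
        _ = max 1 K * 1 := (mul_one _).symm
        _ ≤ max 1 K * max 1 K := mul_le_mul_of_nonneg_left h1' (by positivity)
        _ = (max 1 K) ^ 2 := (sq _).symm
    have h5 : ‖A y μ‖ ^ 2 ≤ (max 1 K * i.η⁻¹ ^ 3 * nJ) ^ 2 := by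
      calc ‖A y μ‖ ^ 2 ≤ K * (i.η⁻¹ ^ 3 * nJ) ^ 2 := h2
        _ ≤ (max 1 K) ^ 2 * (i.η⁻¹ ^ 3 * nJ) ^ 2 := mul_le_mul_of_nonneg_right hmax (by positivity)
        _ = (max 1 K * i.η⁻¹ ^ 3 * nJ) ^ 2 := by ring
    have hnn : 0 ≤ max 1 K * i.η⁻¹ ^ 3 * nJ := by positivity
    exact (pow_le_pow_iff_left₀ (norm_nonneg _) hnn two_ne_zero).mp h5
  · have h0 : A y μ = 0 := (domSubH_le _ hA) y μ hbt
    rw [h0, norm_zero]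
    positivity

end Pointwise

/-! ## §5 The three global (3.47) entries: `GlobAtI` inhabited -/

section Glob

variable [FiniteDimensional ℝ 𝔸] [Nontrivial 𝔸] (τ : 𝔸 →ₗ[ℂ] ℂ) {L : ℕ}
  (hτp : ∀ a : 𝔸, a ≠ 0 → 0 < (τ (star a * a)).re) (hτt : ∀ a b : 𝔸, τ (a * b) = τ (b * a))
  (hτs : ∀ a : 𝔸, τ (star a) = starRingEnd ℂ (τ a))

include hτp hτt hτs in
/-- ★★★ **THE GLOBAL (3.47) BLOCK OF THEOREM 3.3 AT `γ = −3` FOR THE GENUINE `G_𝔤`, PER CUBE MEMBER, ON THE DATA OF THE JUNCTION** — `GlobAtI L (withGopZdH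
(opsAllZd τ L (cubeLamBP …) ops₀)) aT B₀ M i m` with member-dependent `aT, B₀ > 0`: for every `α₀ ≤ aT`, every unitary `U₀ ∈ 𝔄_m({□_j}, α₀)` and every `J`,
`|G_𝔤(U₀)J|₍₋₁₎, |∇_{U₀}G_𝔤(U₀)J|₍₋₂₎, |Δ_{U₀}G_𝔤(U₀)J|₍₋₃₎ ≤ B₀·|J|₍₋₃₎` (the pointwise bound of §4 with the weights `(Lʲη) ≤ (Lᵐη)` and [B8] (1.1)∕(1.39)'s
`‖∇_U f‖ ≤ 2η⁻¹‖f‖_∞`, `‖Δ_U f‖ ≤ 4dη⁻²‖f‖_∞`). [cite: Balaban1985BackgroundPropagators, (3.47) p.398, Thm 3.3 p.399; Balaban1984PropagatorsII, (2.22) p.226; Balaban1985RegularSpaces, (1.59) p.86, (1.7) p.77, (1.131) p.99] -/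
theorem globAtI_withGopZdH_opsAllZd_cube (hd2 : 2 ≤ d) (hL : 2 ≤ L)
    {Cτ : ℝ} (hCτ : ∀ x y : 𝔸, |(τ (star x * y)).re| ≤ Cτ * ‖x‖ * ‖y‖)
    (ops₀ : ℝ → ZdIdx d L → ℕ → OpsZd d 𝔸) (M : ℝ) (i : ZdIdx d L)
    {a : Site d} {Mc ρ : ℕ} (hρ : L ≤ ρ) (hΩ : i.Ω = cubeFam false L a Mc ρ i.k) (hΛs : i.Λs = cubeLamS L a Mc ρ i.k) {m : ℕ} (hm : m ≤ i.k) :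
    ∃ aT : ℝ, 0 < aT ∧ ∃ B₀ : ℝ, 0 < B₀ ∧ GlobAtI L (withGopZdH (opsAllZd τ L (cubeLamBP L a Mc ρ i.k) ops₀)) aT B₀ M i m := by
  have hL1 : 1 ≤ L := le_trans (by norm_num) hL
  have hη : 0 < i.η := i.hη
  have hLr : (1 : ℝ) ≤ L := by exact_mod_cast hL1
  obtain ⟨α, hα, N, hN, h⟩ := exists_apply_bound_gopZdH_of_plaqTouches_cube τ hτp hτt hτs hd2 hL hCτ ops₀ M i hρ hΩ hΛs hm
  obtain ⟨S, hS_def⟩ : ∃ S : ℝ, S = (L : ℝ) ^ m * i.η := ⟨_, rfl⟩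
  have hS0 : 0 < S := by rw [hS_def]; positivity
  -- one constant for the three lines
  obtain ⟨B₀, hB₀_def⟩ : ∃ B₀ : ℝ, B₀ = S * N + S ^ 2 * (2 * i.η⁻¹ * N) + S ^ 3 * (4 * d * (i.η⁻¹ * (i.η⁻¹ * N))) + 1 := ⟨_, rfl⟩
  have hB₀1 : S * N ≤ B₀ := by
    rw [hB₀_def]
    have : 0 ≤ S ^ 2 * (2 * i.η⁻¹ * N) := by positivity
    have : 0 ≤ S ^ 3 * (4 * d * (i.η⁻¹ * (i.η⁻¹ * N))) := by positivity
    linarith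
  have hB₀2 : S ^ 2 * (2 * i.η⁻¹ * N) ≤ B₀ := by
    rw [hB₀_def]
    have : 0 ≤ S * N := by positivity
    have : 0 ≤ S ^ 3 * (4 * d * (i.η⁻¹ * (i.η⁻¹ * N))) := by positivity
    linarith
  have hB₀3 : S ^ 3 * (4 * d * (i.η⁻¹ * (i.η⁻¹ * N))) ≤ B₀ := by
    rw [hB₀_def]
    have : 0 ≤ S * N := by positivity
    have : 0 ≤ S ^ 2 * (2 * i.η⁻¹ * N) := by positivity
    linarith
  have hB₀pos : 0 < B₀ := by
    rw [hB₀_def]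
    have : 0 ≤ S * N := by positivity
    have : 0 ≤ S ^ 2 * (2 * i.η⁻¹ * N) := by positivity
    have : 0 ≤ S ^ 3 * (4 * d * (i.η⁻¹ * (i.η⁻¹ * N))) := by positivity
    linarith
  refine ⟨α, hα, B₀, hB₀pos, fun α₀ U₀ hU₀ _ hα₀ hIn J => ?_⟩
  have hsmall : ∀ (z : Site d) (κ μ : Fin d), κ ≠ μ → PlaqTouches (i.Ω 0) z κ μ → ‖plaqF U₀ κ μ z - 1‖ ≤ α :=
    fun z κ μ hκμ hpt => (B9Thm311PerMemberCubeZdTouching.plaq_le_of_inAk hIn z κ μ hκμ hpt).trans hα₀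
  obtain ⟨-, hpt⟩ := h U₀ hU₀ hsmall
  have hU₀1 : ∀ x κ, U₀ x κ ∈ U1 𝔸 := fun x κ => unitaryUnits_le_U1 (hU₀ x κ)
  obtain ⟨nJ, hnJ_def⟩ : ∃ nJ : ℝ, nJ = bondNorm L m i.η (-(3 : ℝ)) i.Ω J := ⟨_, rfl⟩
  have hnJ0 : 0 ≤ nJ := by rw [hnJ_def]; exact B8ScaledSupNorm.msup_nonneg L m hη.le _ _ _
  obtain ⟨A, hA_def⟩ : ∃ A : Site d → Fin d → 𝔸, A = gopZdH i.η (opsAllZd τ L (cubeLamBP L a Mc ρ i.k) ops₀ M i m) (i.Ω 0) U₀ J := ⟨_, rfl⟩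
  have hAb : ∀ (y : Site d) (μ : Fin d), ‖A y μ‖ ≤ N * nJ := fun y μ => by rw [hA_def, hnJ_def]; exact hpt J y μ
  have hweight : ∀ (n j : ℕ), j ≤ m → weight L i.η (-(n : ℝ)) j ≤ S ^ n := by
    intro n j hj
    rw [B8ScaledSupNorm.weight_neg_natCast, hS_def]
    exact pow_le_pow_left₀ (by positivity) (mul_le_mul_of_nonneg_right (pow_le_pow_right₀ hLr hj) hη.le) n
  rw [withGopZdH_Gop, ← hA_def, ← hnJ_def]
  refine ⟨?_, ?_, ?_⟩
  · -- |G J|₍₋₁₎ ≤ S·N·|J|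
    have e1 : (-(1 : ℝ)) = -((1 : ℕ) : ℝ) := by norm_num
    refine (B8ScaledSupNorm.msup_le (by positivity) fun j hj b _ => ?_).trans (mul_le_mul_of_nonneg_right hB₀1 hnJ0)
    rw [e1]
    calc weight L i.η (-((1 : ℕ) : ℝ)) j * ‖A b.1 b.2‖ ≤ S ^ 1 * (N * nJ) := mul_le_mul (hweight 1 j hj) (hAb b.1 b.2) (norm_nonneg _) (by positivity)
      _ = S * N * nJ := by ring
  · -- |∇ G J|₍₋₂₎ ≤ S²·2η⁻¹N·|J|
    have e2 : (-(2 : ℝ)) = -((2 : ℕ) : ℝ) := by norm_num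
    refine (B8ScaledSupNorm.msup_le (by positivity) fun j hj t _ => ?_).trans (mul_le_mul_of_nonneg_right hB₀2 hnJ0)
    rw [e2]
    have hD : ‖covDerivFwd i.η U₀ t.1 (fun z => A z t.2.1) t.2.2‖ ≤ i.η⁻¹ * (N * nJ + N * nJ) :=
      (norm_covDerivFwd_le hη (hU₀1 _ _) _).trans (mul_le_mul_of_nonneg_left (add_le_add (hAb _ _) (hAb _ _)) (inv_nonneg.mpr hη.le))
    calc weight L i.η (-((2 : ℕ) : ℝ)) j * ‖covDerivFwd i.η U₀ t.1 (fun z => A z t.2.1) t.2.2‖ ≤ S ^ 2 * (i.η⁻¹ * (N * nJ + N * nJ)) :=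
          mul_le_mul (hweight 2 j hj) hD (norm_nonneg _) (by positivity)
      _ = S ^ 2 * (2 * i.η⁻¹ * N) * nJ := by ring
  · -- |Δ G J|₍₋₃₎ ≤ S³·4dη⁻²N·|J|
    have e3 : (-(3 : ℝ)) = -((3 : ℕ) : ℝ) := by norm_num
    refine (B8ScaledSupNorm.msup_le (by positivity) fun j hj b _ => ?_).trans (mul_le_mul_of_nonneg_right hB₀3 hnJ0)
    rw [e3]
    have hD : ‖covLap i.η U₀ (fun w => A w b.2) b.1‖ ≤ 4 * d * (i.η⁻¹ * (i.η⁻¹ * (N * nJ))) :=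
      norm_covLap_le hη hU₀1 (fun w => hAb w b.2) b.1
    calc weight L i.η (-((3 : ℕ) : ℝ)) j * ‖covLap i.η U₀ (fun w => A w b.2) b.1‖ ≤ S ^ 3 * (4 * d * (i.η⁻¹ * (i.η⁻¹ * (N * nJ)))) :=
          mul_le_mul (hweight 3 j hj) hD (norm_nonneg _) (by positivity)
      _ = S ^ 3 * (4 * d * (i.η⁻¹ * (i.η⁻¹ * N))) * nJ := by ring

end Glob

/-! ## §6 The β collar socket at every cube member for the genuine record, unconditional -/

section Socket

variable [FiniteDimensional ℝ 𝔸] [Nontrivial 𝔸] (τ : 𝔸 →ₗ[ℂ] ℂ) {L : ℕ}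
  (hτp : ∀ a : 𝔸, a ≠ 0 → 0 < (τ (star a * a)).re) (hτt : ∀ a b : 𝔸, τ (a * b) = τ (b * a))
  (hτs : ∀ a : 𝔸, τ (star a) = starRingEnd ℂ (τ a))

include hτp hτt hτs in
/-- ★★★★ **THE β COLLAR SOCKET OF [B8] (1.59) AT EVERY CUBE MEMBER FOR THE GENUINE RECORD — UNCONDITIONAL.**  At a cube member of [Balaban1985RegularSpaces]
(1.131) (`Ω = cubeFam false L a Mc ρ k`, `Λs = cubeLamS …`, every truncation `m ≤ k`, `2 ≤ d`, `2 ≤ L ≤ ρ`), for the record `withGopZdH (opsAllZd τ L (cubeLamBP …)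
ops₀)` (genuine `G_𝔤 = (□₀Δ_a□₀)⁻¹`, `Δ′`, `D R 𝟙 D*`, `Q*aQ` at print's class) on a finite-dimensional fibre with faithful Hermitian tracial `τ`, `|Re τ(x*y)|
≤ C_τ‖x‖‖y‖`, and any block parameter `M ≥ 1`: THERE ARE `aI, B₀ > 0` (member-dependent) with the four-line collar socket `SockB9P3D4β L B₀′ ((20d+2)B₀′) cP
i.η m i.Ω i.Λs (cubeLamBP …)`, `B₀′ = max{1, 2B₀max{1,q}}`, `q = qQ d L C_τ β_τ 1`, `cP = min{1∕16, aI, 1∕(2B₀·14(d−1)·M+1)}` — every binder of the frame-free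
supplier `sockB9P3D4βU_at` discharged by name: `InvAtHI` (g20), `CurvAtInAk` (`curvAtInAk_opsAllZd`), `LandauAtU` (§1), `AvgAtγ` (`avgAtγ_opsAllZd_cubeLamBP`,
EDITION P₀), `GlobAtI` (§5), `SeesDom` (`seesDom_cubeLamBP`), `Margin2` (`margin2_cubeFam`).  The junction J-N06→N05 at a cube member with NO hypothesis of
Bałaban's left — per member; print's uniformity in the member (Thm 3.3 ∕ 3.11 proper) is what [B8]'s Theorem 4 needs beyond this.
[cite: Balaban1985RegularSpaces, (1.58)–(1.59) p.86, Prop. 3 p.87, (1.131) p.99, (1.7) p.77; Balaban1985BackgroundPropagators, Thm 3.3 p.399, (3.47) p.398, (3.27) p.395, Thm 3.11 p.416, (3.69) p.404, (3.16) p.393; Balaban1984PropagatorsII, (2.22) p.226, (2.3) p.224] -/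
theorem sockB9P3D4β_genuine_cube [NeZero L] (hd2 : 2 ≤ d) (hL : 2 ≤ L)
    {Cτ : ℝ} (hCτ : ∀ x y : 𝔸, |(τ (star x * y)).re| ≤ Cτ * ‖x‖ * ‖y‖)
    (ops₀ : ℝ → ZdIdx d L → ℕ → OpsZd d 𝔸) {M : ℝ} (hM1 : 1 ≤ M) (i : ZdIdx d L)
    {a : Site d} {Mc ρ : ℕ} (hρ : L ≤ ρ) (hΩ : i.Ω = cubeFam false L a Mc ρ i.k) (hΛs : i.Λs = cubeLamS L a Mc ρ i.k) {m : ℕ} (hm : m ≤ i.k) :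
    ∃ aI : ℝ, 0 < aI ∧ ∃ B₀ : ℝ, 0 < B₀ ∧
      SockB9P3D4β (𝔸 := 𝔸) L (max 1 (2 * B₀ * max 1 (qQ d L Cτ (betaTau τ) 1)))
        ((20 * d + 2) * max 1 (2 * B₀ * max 1 (qQ d L Cτ (betaTau τ) 1)))
        (min (1 / 16) (min aI (1 / (2 * B₀ * (14 * ((d - 1 : ℕ) : ℝ)) * M + 1))))
        i.η m i.Ω i.Λs (cubeLamBP L a Mc ρ i.k) := by
  have hL1 : 1 ≤ L := le_trans (by norm_num) hL
  have hfin : (i.Ω 0).Finite := cubeMember_Ω0_finite i hΩ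
  have hMi : Margin2 i.Ω := by rw [hΩ]; exact margin2_cubeFam L a Mc (le_trans hL hρ) i.k
  have hsee : SeesDom L m (i.Ω 0) (cubeLamBP L a Mc ρ i.k) := by rw [hΩ]; exact seesDom_cubeLamBP hL1 a Mc hρ hm
  have hq : 0 ≤ qQ d L Cτ (betaTau τ) 1 := by
    have hCτ0 : 0 ≤ Cτ := by
      have h := hCτ 1 1
      rw [star_one, one_mul, norm_one, mul_one, mul_one] at h
      exact le_trans (abs_nonneg _) h
    have hβ : 0 ≤ betaTau τ := by
      unfold betaTau
      split_ifs
      · exact Finset.sum_nonneg fun i _ => mul_nonneg (norm_nonneg _) (norm_nonneg _)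
      · exact le_rfl
    have hα : 0 ≤ B9Eq316AveragingTransposeZd.alphaQ d L := (B9Eq316AveragingTransposeZd.alphaQ_pos d hL1).le
    have hθ : 0 ≤ B7Prop5GeneralLevels.thetaGen d L (B9Eq316AveragingTransposeZd.alphaQ d L) := by
      unfold B7Prop5GeneralLevels.thetaGen; positivity
    unfold qQ; positivity
  obtain ⟨aI, haI, hinv⟩ := invAtHI_withGopZdH_opsAllZd_cube τ hτp hτt hτs hd2 hL ops₀ M i hρ hΩ hΛs hm
  obtain ⟨aT, haT, B₀, hB₀, hglob⟩ := globAtI_withGopZdH_opsAllZd_cube τ hτp hτt hτs hd2 hL hCτ ops₀ M i hρ hΩ hΛs hm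
  refine ⟨min aI aT, lt_min haI haT, B₀, hB₀, ?_⟩
  exact sockB9P3D4βU_at L (withGopZdH (opsAllZd τ L (cubeLamBP L a Mc ρ i.k) ops₀)) hd2 hL1 hM1 i hMi
    (invAtHI_anti L (min_le_left _ _) hinv)
    ((curvAtInAk_withGopZdH_iff _ M i m _).mpr (curvAtInAk_opsAllZd τ L (cubeLamBP L a Mc ρ i.k) ops₀ hL1 hM1 i m))
    (landauAtU_withGopZdH_opsAllZd τ hτp hτt hτs (cubeLamBP L a Mc ρ i.k) ops₀ M i m hfin)
    (cubeLamBP L a Mc ρ i.k)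
    ((avgAtγ_withGopZdH_iff _ M i m _ _).mpr (avgAtγ_opsAllZd_cubeLamBP τ hd2 hL hCτ ops₀ M i hρ hΩ hm))
    hsee (globAtI_anti L (min_le_right _ _) le_rfl hglob) (by positivity) hq hB₀

end Socket

end Literature.MathematicalPhysics.QuantumFieldTheory.Balaban1983to89.B9Thm33GlobalBlockWitnessCubeZd

end
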